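import Literature.Probability.LatticeModels.SpinWaveComplexStabilityTorus
import Summits.HubbardSuperconductivity.HubbardSuperconductivity.Theorems.NodalWardXYDefs
import Summits.HubbardSuperconductivity.HubbardSuperconductivity.Theorems.NodalWardXYPerturbedXYOrderEntire
import Summits.HubbardSuperconductivity.HubbardSuperconductivity.Theorems.NodalWardXYPerturbedXYOrderSmallVolume

/-!
# `PerturbedXYOrder` (stmt-HubbardSuperconductivity-10739) — line `schwarz-inheritance`, stubs `stub_nearRealStability` and `stub_mesoscopicStability`

Delineation: zeros of `K ↦ Z_K` need imaginary parts of `K` of size `≳ 1/L³`; real parts are harmless.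
Since the currents `j_b = sin ∇_b θ` are real, `Im W_K(θ) = Σ_{b,b'} Im K(b,b') j_b j_{b'} = Re W_{Im K}(θ)`.
If `|Im K(b,b')| ≤ δ (1 + dist)⁻⁴` then the real kernel `Im K` is admissible at radius `δ`, so the uniform
row-sum bound `Σ_{b'} |Im K(b,b')| ≤ 144 δ` (`row_sum_norm_le_of_admissible`, `3L³` bonds, `|j_b| ≤ 1`) gives
`|Im W_K| ≤ ‖W_{Im K}‖ ≤ 432 δ L³`, i.e. `|Im W_K| ≤ 1` pointwise as soon as
`432 δ L³ ≤ 1`, with NO assumption on `Re W_K`.  The weight `w_J > 0` is real, so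
`Re (w_J e^{W_K}) = w_J e^{Re W_K} cos (Im W_K) ≥ ½ ‖w_J e^{W_K}‖` (`cos x ≥ 1/2` for `|x| ≤ 1`); integrating
over the cube, `‖Z_K‖ ≥ Re Z_K ≥ ½ ∫ ‖w_J e^{W_K}‖ > 0` and `‖num_K‖ ≤ L⁶ ∫ ‖w_J e^{W_K}‖`, whence `Z_K ≠ 0`
and `‖num_K / Z_K / L⁶‖ ≤ 2`.  The mesoscopic corollary (`K` admissible at radius `ε`, `432 ε L³ ≤ 1`)
follows from `|Im K| ≤ ‖K‖`.
-/

noncomputable section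

namespace Summit.HubbardSuperconductivity.HubbardSuperconductivity.Theorems.PerturbedXYOrder

open MeasureTheory Literature.Probability.LatticeModels
open Summit.HubbardSuperconductivity.HubbardSuperconductivity.Theses.NodalWardXY

variable {L : ℕ}

/-- The currents are real, so the imaginary part of the perturbation is the real part of the
perturbation with the real kernel `Im K`: `Im W_K(θ) = Re W_{Im K}(θ)`. -/
theorem nr_im_Wk_eq [NeZero L] (K : Bond L → Bond L → ℂ) (θ : TorusSite 3 L → ℝ) :
    (Wk K θ).im = (Wk (fun b b' => (((K b b').im : ℝ) : ℂ)) θ).re := by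
  unfold Wk
  simp [Complex.re_sum, Complex.im_sum, Complex.mul_re, Complex.mul_im]

/-- A kernel with `|Im K(b,b')| ≤ δ (1 + dist(x,x'))⁻⁴` has real kernel `Im K` admissible at radius `δ`. -/
theorem nr_admissible_im [NeZero L] {δ : ℝ} {K : Bond L → Bond L → ℂ}
    (hK : ∀ b b' : Bond L, |(K b b').im| ≤ δ / (1 + ((torusGraph 3 L).dist b.1 b'.1 : ℝ)) ^ 4) :
    Admissible L δ (fun b b' => (((K b b').im : ℝ) : ℂ)) := by
  intro b b'
  rw [Complex.norm_real, Real.norm_eq_abs]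
  exact hK b b'

/-- Near-real kernels have a perturbation with small imaginary part, uniformly in the volume per site:
`|Im W_K(θ)| ≤ ‖W_{Im K}(θ)‖ ≤ 432 δ L³` (`|j_b| ≤ 1`, row sums `Σ_{b'} |Im K(b,b')| ≤ 144 δ`, `3L³` directed bonds). -/
theorem nr_abs_im_Wk_le [NeZero L] {δ : ℝ} {K : Bond L → Bond L → ℂ}
    (hK : ∀ b b' : Bond L, |(K b b').im| ≤ δ / (1 + ((torusGraph 3 L).dist b.1 b'.1 : ℝ)) ^ 4)
    (θ : TorusSite 3 L → ℝ) : |(Wk K θ).im| ≤ 432 * δ * (L : ℝ) ^ 3 := by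
  have hKI := nr_admissible_im hK
  rw [nr_im_Wk_eq K θ]
  refine (Complex.abs_re_le_norm _).trans ?_
  calc ‖Wk (fun b b' => (((K b b').im : ℝ) : ℂ)) θ‖
      ≤ ∑ b : Bond L, ∑ b' : Bond L, ‖(((K b b').im : ℝ) : ℂ)‖ := ent_norm_Wk_le _ θ
    _ ≤ ∑ _b : Bond L, 144 * δ := Finset.sum_le_sum fun b _ => row_sum_norm_le_of_admissible _ hKI b
    _ = 432 * δ * (L : ℝ) ^ 3 := by
        simp only [Finset.sum_const, Finset.card_univ, nsmul_eq_mul, Fintype.card_prod, Fintype.card_fin,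
          Fintype.card_fun, ZMod.card]
        push_cast; ring

/-- Pointwise sector estimate: for `0 ≤ r` and `|Im W| ≤ 1`, `‖r e^{W}‖ ≤ 2 Re (r e^{W})`
(no assumption on `Re W`). -/
theorem nr_norm_le_two_mul_re {r : ℝ} (hr : 0 ≤ r) {W : ℂ} (hW : |W.im| ≤ 1) :
    ‖(r : ℂ) * Complex.exp W‖ ≤ 2 * ((r : ℂ) * Complex.exp W).re := by
  rw [norm_mul, Complex.norm_real, Real.norm_eq_abs, abs_of_nonneg hr, Complex.norm_exp,
    Complex.re_ofReal_mul, Complex.exp_re]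
  have hcos : (1:ℝ) / 2 ≤ Real.cos W.im := sv_half_le_cos hW
  have hre : 0 ≤ r * Real.exp W.re := mul_nonneg hr (Real.exp_pos _).le
  have key : 0 ≤ r * Real.exp W.re * (2 * Real.cos W.im - 1) := mul_nonneg hre (by linarith)
  nlinarith [key]

/-- If `|Im W_K| ≤ 1` pointwise on configurations then `∫_cube ‖w_J e^{W_K}‖ ≤ 2 ‖Z_K‖`
(via `Re Z_K = ∫ Re (w_J e^{W_K}) ≥ ½ ∫ ‖w_J e^{W_K}‖`). -/
theorem nr_integral_norm_le_two_mul_norm_Zk [NeZero L] (J : ℝ) {K : Bond L → Bond L → ℂ}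
    (hW : ∀ θ : TorusSite 3 L → ℝ, |(Wk K θ).im| ≤ 1) :
    ∫ θ in cube L, ‖wJ J θ * Complex.exp (Wk K θ)‖ ≤ 2 * ‖Zk J K‖ := by
  have hfi := sv_integrable_integrand J K
  have hpt : ∀ θ : TorusSite 3 L → ℝ,
      ‖wJ J θ * Complex.exp (Wk K θ)‖ ≤ 2 * (wJ J θ * Complex.exp (Wk K θ)).re :=
    fun θ => by
      unfold wJ
      exact nr_norm_le_two_mul_re (Real.exp_pos _).le (hW θ)
  have hrei : Integrable (fun θ : TorusSite 3 L → ℝ => 2 * (wJ J θ * Complex.exp (Wk K θ)).re)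
      (volume.restrict (cube L)) :=
    ((Complex.continuous_re.comp (sv_continuous_integrand J K)).continuousOn.integrableOn_compact
      ent_isCompact_cube).const_mul 2
  have hre : ∫ θ in cube L, (wJ J θ * Complex.exp (Wk K θ)).re = (Zk J K).re := by
    have h := integral_re hfi
    simp only [RCLike.re_to_complex] at h
    exact h
  calc ∫ θ in cube L, ‖wJ J θ * Complex.exp (Wk K θ)‖
      ≤ ∫ θ in cube L, 2 * (wJ J θ * Complex.exp (Wk K θ)).re := integral_mono hfi.norm hrei hpt
    _ = 2 * (Zk J K).re := by rw [integral_const_mul, hre]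
    _ ≤ 2 * ‖Zk J K‖ := by gcongr; exact Complex.re_le_norm _

/-- If `|Im W_K| ≤ 1` pointwise on configurations then `Z_K ≠ 0` and `‖num_K / Z_K / L⁶‖ ≤ 2`
(`‖Z_K‖ ≥ ½ ∫ ‖w_J e^{W_K}‖ > 0` and `‖num_K‖ ≤ L⁶ ∫ ‖w_J e^{W_K}‖`). -/
theorem nr_stability_of_abs_im_Wk_le_one [NeZero L] (J : ℝ) {K : Bond L → Bond L → ℂ}
    (hW : ∀ θ : TorusSite 3 L → ℝ, |(Wk K θ).im| ≤ 1) : Zk J K ≠ 0 ∧ ‖cratio L J K‖ ≤ 2 := by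
  have hIpos := sv_integral_norm_pos (L := L) J K
  have hIle := nr_integral_norm_le_two_mul_norm_Zk J hW
  have hnum := sv_norm_num_le (L := L) J K
  have hZpos : 0 < ‖Zk J K‖ := by linarith
  have hZne : Zk J K ≠ 0 := norm_pos_iff.1 hZpos
  refine ⟨hZne, ?_⟩
  have hL : (0:ℝ) < (L : ℝ) ^ 6 := by
    have := NeZero.pos L; positivity
  unfold cratio
  rw [norm_div, norm_div]
  have hL' : ‖((L : ℂ)) ^ 6‖ = (L : ℝ) ^ 6 := by simp
  rw [hL', div_div, div_le_iff₀ (mul_pos hZpos hL)]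
  calc ‖num J K‖ ≤ (L : ℝ) ^ 6 * ∫ θ in cube L, ‖wJ J θ * Complex.exp (Wk K θ)‖ := hnum
    _ ≤ (L : ℝ) ^ 6 * (2 * ‖Zk J K‖) := by gcongr
    _ = 2 * (‖Zk J K‖ * (L : ℝ) ^ 6) := by ring

/-- **Near-real kernels are harmless at every coupling and every volume with `432 δ L³ ≤ 1`.** If the
imaginary parts of the kernel satisfy `|Im K(b,b')| ≤ δ (1 + dist(x,x'))⁻⁴` with `432 δ L³ ≤ 1` (no assumption
on `Re K`), then `Z_K ≠ 0` and `‖num_K / Z_K / L⁶‖ ≤ 2`: `Im W_K = Re W_{Im K}` has `|Im W_K| ≤ 432 δ L³ ≤ 1`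
pointwise, so `Re (w_J e^{W_K}) ≥ ½ ‖w_J e^{W_K}‖`, whence `‖Z_K‖ ≥ ½ ∫ ‖w_J e^{W_K}‖ > 0` and
`‖num_K‖ ≤ L⁶ ∫ ‖w_J e^{W_K}‖`. -/
theorem stub_nearRealStability : ∀ (L : ℕ) [NeZero L] (δ : ℝ), 432 * δ * (L : ℝ) ^ 3 ≤ 1 →
    ∀ (J : ℝ) (K : Bond L → Bond L → ℂ),
      (∀ b b' : Bond L, |(K b b').im| ≤ δ / (1 + ((torusGraph 3 L).dist b.1 b'.1 : ℝ)) ^ 4) →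
        Zk J K ≠ 0 ∧ ‖cratio L J K‖ ≤ 2 := by
  intro L _ δ hδL J K hK
  exact nr_stability_of_abs_im_Wk_le_one J fun θ => (nr_abs_im_Wk_le hK θ).trans hδL

/-- **Mesoscopic volumes are free at every coupling.** If `432 ε L³ ≤ 1` then for every `J` and every kernel
`K` admissible at radius `ε` on the torus `(ℤ/Lℤ)³`, `Z_K ≠ 0` and `‖num_K / Z_K / L⁶‖ ≤ 2`
(corollary of `stub_nearRealStability` via `|Im K(b,b')| ≤ ‖K(b,b')‖`). -/
theorem stub_mesoscopicStability : ∀ (L : ℕ) [NeZero L] (ε : ℝ), 432 * ε * (L : ℝ) ^ 3 ≤ 1 →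
    ∀ (J : ℝ) (K : Bond L → Bond L → ℂ), Admissible L ε K → Zk J K ≠ 0 ∧ ‖cratio L J K‖ ≤ 2 := by
  intro L _ ε hεL J K hK
  exact stub_nearRealStability L ε hεL J K fun b b' => (Complex.abs_im_le_norm _).trans (hK b b')

end Summit.HubbardSuperconductivity.HubbardSuperconductivity.Theorems.PerturbedXYOrder

end
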